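/-
Copyright: statement-level skeleton of a published paper (lit-balaban cell, Phase-2 proof seat p39 gen 17). No proof claims
beyond what the kernel checks below.
-/
import Literature.MathematicalPhysics.QuantumFieldTheory.Balaban1983to89.B3Bound316ZeroLattice
import Literature.MathematicalPhysics.QuantumFieldTheory.Balaban1983to89.B3Ineq314ZeroLattice

/-!
# B3 — T. Bałaban, *(Higgs)₂,₃ quantum fields in a finite volume. III. Renormalization*, CMP **88** (1983) 411–445
[Balaban1983Higgs3], p. 437 [PDF 27], **(3.17) ON THE PRINT'S OWN CARRIER**: *"Thus we have finished the analysis of (3.8) and we can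
summarize it in the following graphical form [(3.8) summed = (generalized graph (3.12)) + (local vertex)] (3.17). It is of the
required form (3.5)."* — PROVED END TO END for the infinite-lattice zero-field propagator `G_k(0) = G_k(ηℤ³, 0)` of p. 433 and its
(2.6)-pieces: the sum over the line indices `j, j′ < j″` of the expressions (3.9) of the graph (3.8) EQUALS minus the local vertex
(3.15) of the resummed propagator — whose coefficient is BOUNDED uniformly in the scale (via (3.16), `B3Bound316ZeroLattice`) —
minus the generalized expressions (3.12), each obeying the generalized-graph estimate (3.13)

statement-level skeleton of published theorems with citation tags; proofs where landed; nothing here is a claim about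
the Yang–Mills mass gap

PDF held: `paper:balaban1983-higgs-2-3-quantum-fields-finite-volume` (journal page = PDF page + 410); pp. 435–437 [PDF 25–27] read in
the OCR text (`p0025.txt`–`p0027.txt` of `lit read`).

CITATION HEADER (lean-in-tree rule).  Part of the lit-balaban TYPED SKELETON (HOME `run/shared/lean/pub/lit-balaban/`), Phase 2,
proof seat p39 generation 17 (file 3 of the generation).  Row **B3.Eq3.11-3.17** of `HOME/lit-balaban-r15/ROWS-B3.md` (fold owner
r15), sub-display (3.17) and the p. 437 closing sentences — the lattice twin of p20 g6's TORUS file `B3Eq317ZeroTorus`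
(`eq317_zero_torus`), on the carrier the fold owner's correction ROWS v1.207 identifies as the print's (*"the zero-field
infinite-lattice scalar propagator G_k(0) = G_k(ηℤ^d,0)"*).  It is an ASSEMBLY, by name, of: p26 g34's lattice chain
`B3Taylor310Lattice` ((3.10): `pd`, `rem`, `taylor310`), `B3Ineq313Lattice` ((3.9) `expr39Z`, (3.11) `eq311Z` with its first term
`term311Z` and (3.12) `term312Z`, bilinearity `eq315Z_resum`) and `B3Ineq314ZeroLattice` (the pieces `gpieceZ` of `G_k(0)` in the
print's normalisation, the resummed `GresumZ`, (3.15) `eq315Z_zeroLattice`, (3.13)/(3.14) hypothesis-free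
`abs_term312Z_le_zeroLattice`), and this seat's `B3Bound316ZeroLattice` (file 1 of the generation: the (3.15) bracket `bracket315L`
as a series over `ℤ³`, the vertex `expr315L`, (3.15) = (3.16), *"we can estimate (3.16) by a constant"*
`exists_bracket315L_GxiL_bound`, `exists_expr315L_GxiL_bound`).  Nothing of theirs is restated; §1 is the one-line dictionary
between the two vocabularies at `d + 1 = 3`.

THE PRINTED TEXT (verbatim, p. 437).  *"Let us consider the first expression on the right side of (3.11). The same expression
appears for all orderings of the lines of the graph G₀ with the only condition that they are earlier than the external lines.
Making summations over these orderings and indices means that we sum with respect to j, j′ from 0 to j″, where j″ is the lowest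
index of the external lines. After the summations we get [(3.15)] and this expression is represented graphically by [a two-leg
vertex]. Let us estimate the coefficient in the vertex … we can estimate (3.16) by a constant. Thus we have finished the analysis
of (3.8) and we can summarize it in the following graphical form (3.17). It is of the required form (3.5)."*

WHAT IS PROVED (`d = 3`: `ℤ³ = Fin (2+1) → ℤ = ZSite 3`; `η = L^{−k}` = p26's `etaZ ℓ k` = gen 9's `xiOf ℓ k`; window `[a₋,a₊] ×
[0,m²₊]`, `a₋ > 0`).
* §1 DICTIONARY: `etaZ_eq_xiOf`, `gpieceZ_eq_pieceXi` (p26's `ξ³`-normalised pieces = `B3Bound316ZeroLattice.pieceXi`),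
  `GresumZ_top_eq_GxiL` (`𝒢_k = G^ξ_k(0) = GxiL ℓ k`), `sum_dKernelZ_eq_d2diag`, `coeff39Z_mul_disp_eq_term315` (p26's bracket summand
  = `term315` with the printed displacement `dispZ`), **`term311Z_eq_sum_term315`**: p26's first term of (3.11) over finite `Λ, Λ′`
  is `Σ_μΣ_{x∈Λ}η³(Σ_{x′∈Λ′}term315(x,x′))·⟨φ(x), q²(∂^η_μφ′)(x)⟩` — a PARTIAL SUM in `x′` of the series of `B3Bound316ZeroLattice`.
* §2 **`tendsto_term311Z`**: as the localization set `Λ′` of the summed line exhausts `ℤ³` (filter `atTop` on `Finset ℤ³`),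
  `term311Z(Λ,Λ′) → −expr315L(Λ)` — the print's (3.15), whose square bracket sums `x′` over the whole lattice — whenever the bracket
  series converge (here: always, for the (2.10) class).
* §3 **`sum_expr39Z_eq`** (every `1 ≤ n ≤ k`): `Σ_{j,j′<n}(3.9)[G^η_{(j)}(0),G^η_{(j′)}(0)](Λ,Λ′) = −term311Z[𝒢_n,𝒢_n](Λ,Λ′) −
  Σ_{j,j′<n}(3.12)[j,j′](Λ,Λ′)` (p26's `eq311Z` per pair + `eq315Z_zeroLattice`); `sum_expr39Z_eq_top` (`n = k`: the resummed
  propagator is `G^ξ_k(0)` itself); `tendsto_term311Z_GxiL`; and **`eq317_zeroLattice`** — `∃ δ′ C′ Cst > 0` (on `L` and the window)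
  such that for EVERY `k ≥ 1`, window point, `‖q·‖ ≤ Q‖·‖`, `|g|,|g′| ≤ 1`, fields `φ, φ′` with Hölder-`α` derivative legs, finite `Λ`:
  (a) the identity for every `Λ′`; (b) the resummed term converges, as `Λ′ ↑ ℤ³`, to minus the FULL vertex (3.15) of `G_k(0)`, and
  `|(3.15)| ≤ Cst·Σ_μΣ_{x∈Λ}η³‖φ(x)‖‖q²(∂^η_μφ′)(x)‖`; (c) every piece `(j,j′)` satisfies (3.13) with the printed factors
  `(L^jη)^{−d}e^{−½δ′|x−x′|/L^jη}(L^{j′}η)^{−d+2}e^{…}(L^{j₁}η)^{1+α}` (`d ↦ 3`) — the summed expression of (3.8) is *"Σ generalized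
  expressions"* + *"a vertex with a bounded function"*, the required form (3.5) for this graph, ON THE PRINTED CARRIER.
HONEST SCOPE: `d = 3` (as `B3Bound316ZeroLattice`; p26's chain is general `d`); zero field, unit blocks; the vertex clauses (b) at
the TOP index `j″ = k` only (`𝒢_k = G_k(0)`): for an intermediate `j″ = n < k` the identity (a) holds verbatim (`sum_expr39Z_eq`) but
the vertex bound needs the scale dictionary `𝒢_n` (p26's `GscaleLat ℓ k n`) = the rescaled lower-step propagator `G_n(0)` with mass
`m²(L^nη)²` (gen 11's `GetaL`; [B4] (2.44) at lattice level) — NOT in the tree yet, flagged to p26 (lattice lineage) 2026-08-23; on the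
torus this dictionary is implicit (p20's tower is defined scale by scale on one lattice, `B3Eq317ZeroTorus` covers every `k = j″ ≤ K`);
the summation over orderings taken literally over `[0,n)²` ((2.6) index convention, as p20/p26); the picture (3.17) as a graph
object (p18/p26 vocabulary) and Proposition 2.2 for the generalized graphs are not claimed.  Mathlib + the cited tree files only;
theorems only, no definitions, no named facts; standard axioms.  Unit `lit-balaban-p39-g17` (Phase-2 proof seat p39, gen 17), HOME
`run/shared/lean/pub/lit-balaban/`, 2026-08-23.
-/

open scoped BigOperators RealInnerProductSpace
open Finset Filter Topology

namespace Literature.MathematicalPhysics.QuantumFieldTheory.Balaban1983to89.B3Eq317ZeroLattice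

open B3Sect3VectorSelfEnergy (ZSite unitVec Cxi)
open B3Eq316ResolventZeroLattice (xiOf GxiL MxiL xiOf_pos xiOf_le_one)
open B3Eq316DifferenceKernelBounds (prof d2K)
open B3Bound316ZeroLattice (dispZ d2diag term315 bracket315L expr315L pieceXi exists_bracket316L_bound
  exists_bracket315L_GxiL_bound abs_expr315L_le exists_expr315L_GxiL_bound)
open B3Taylor310Lattice (pd dist₁)
open B3Ineq313Lattice (KernelZ dKernelZ coeff39Z expr39Z term311Z term312Z eq311Z)
open B3Ineq314ZeroLattice (etaZ scaleZ gpieceZ GresumZ GresumZ_top eq315Z_zeroLattice abs_term312Z_le_zeroLattice)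
open B3GkZeroLattice (GkLat)
open _root_.Filter

noncomputable section

/-! ## §1 The dictionary between p26's `ηℤ^{d+1}` objects at `d + 1 = 3` and the `ℤ³` objects of `B3Bound316ZeroLattice` -/

section Dictionary

variable {ℓ k : ℕ} {a m2 : ℝ}

/-- kernel: `η = L^{−k}` in the two spellings (`etaZ` with a `ℕ`-power cast, `xiOf` with a real power).
[cite: Balaban1983Higgs3, (1.1) p.412] -/
theorem etaZ_eq_xiOf (ℓ k : ℕ) : etaZ ℓ k = xiOf ℓ k := by
  simp [etaZ, xiOf, Nat.cast_pow]

/-- kernel: p26's `ξ³`-normalised pieces ARE `B3Bound316ZeroLattice.pieceXi` (same normalisation `(L^k)³·pieceLat`).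
[cite: Balaban1983Higgs3, (2.6) p.424] -/
theorem gpieceZ_eq_pieceXi (ℓ k j : ℕ) (a m2 : ℝ) : gpieceZ (d := 2) ℓ k j a m2 = pieceXi ℓ k j a m2 := by
  funext x x'
  simp [gpieceZ, pieceXi, Nat.cast_pow]

/-- kernel: the top resummed propagator `𝒢_k = Σ_{j<k}G^η_{(j)}(0)` in p26's normalisation IS gen 9's `G^ξ_k(0) = GxiL ℓ k`.
[cite: Balaban1983Higgs3, (3.15) p.437] -/
theorem GresumZ_top_eq_GxiL (ℓ k : ℕ) (a m2 : ℝ) : GresumZ (d := 2) ℓ k k a m2 = GxiL ℓ k a m2 := by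
  funext x x'
  rw [GresumZ_top]
  simp [GxiL, Nat.cast_pow]

/-- kernel: p26's `Σ_μ(∂^η_μG∂^{η*}_μ)` (`dKernelZ η⁻¹`) is `d2diag η` of `B3Bound316ZeroLattice`. [cite: Balaban1983Higgs3, (3.9) p.435] -/
theorem sum_dKernelZ_eq_d2diag (η : ℝ) (G : KernelZ 2) (x x' : ZSite 3) :
    ∑ μ : Fin (2 + 1), dKernelZ η⁻¹ μ G x x' = d2diag η G x x' := by
  simp only [d2diag, dKernelZ, d2K, unitVec, inv_pow]

/-- **THE INTEGRAND DICTIONARY**: p26's `η^{d+1}·c(x,x′)·(x′_μ − x_μ)` (the bracket summand of `term311Z`) is the (3.15)-summand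
`term315` of `B3Bound316ZeroLattice` with the printed displacement `dispZ`. [cite: Balaban1983Higgs3, (3.15) p.437] -/
theorem coeff39Z_mul_disp_eq_term315 (η : ℝ) (Gj Gj' : KernelZ 2) (g g' : ZSite 3 → ℝ) (μ : Fin 3) (x x' : ZSite 3) :
    η ^ (2 + 1) * (coeff39Z η Gj Gj' g g' x x' * (η * ((x' μ - x μ : ℤ) : ℝ))) =
      term315 η Gj Gj' g g' (dispZ η) μ x x' := by
  simp only [coeff39Z]
  rw [sum_dKernelZ_eq_d2diag]
  simp only [term315, dispZ, Int.cast_sub]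

variable {W : Type*} [NormedAddCommGroup W] [InnerProductSpace ℝ W]

/-- **THE FIRST TERM OF (3.11)/(3.15) IN THE TWO VOCABULARIES**: p26's `term311Z[Λ, Λ′]` is `Σ_μΣ_{x∈Λ}η³·(Σ_{x′∈Λ′} term315(x,x′))
·⟨φ(x), q²(∂^η_μφ′)(x)⟩` — the PARTIAL SUM over the finite localization set `Λ′` of the series `bracket315L` of
`B3Bound316ZeroLattice`. [cite: Balaban1983Higgs3, (3.15) p.437] -/
theorem term311Z_eq_sum_term315 (η : ℝ) (q : W →ₗ[ℝ] W) (Gj Gj' : KernelZ 2) (g g' : ZSite 3 → ℝ)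
    (φ φ' : ZSite 3 → W) (Λ Λ' : Finset (ZSite 3)) :
    term311Z η q Gj Gj' g g' φ φ' Λ Λ' =
      ∑ μ : Fin 3, ∑ x ∈ Λ, η ^ 3 * ((∑ x' ∈ Λ', term315 η Gj Gj' g g' (dispZ η) μ x x') *
        ⟪φ x, q (q (pd η⁻¹ μ φ' x))⟫) := by
  unfold term311Z
  refine Finset.sum_congr rfl fun μ _ => Finset.sum_congr rfl fun x _ => ?_
  have e3 : (η ^ (2 + 1) : ℝ) = η ^ 3 := by norm_num
  rw [← e3]
  congr 2
  exact Finset.sum_congr rfl fun x' _ => coeff39Z_mul_disp_eq_term315 η Gj Gj' g g' μ x x'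

end Dictionary

/-! ## §2 The limit `Λ′ ↑ ℤ³`: the partial sums of (3.15) converge to the full vertex `expr315L` -/

section Limit

variable {W : Type*} [NormedAddCommGroup W] [InnerProductSpace ℝ W]

/-- **AS THE LOCALIZATION SET `Λ′` OF THE SUMMED LINE EXHAUSTS THE LATTICE, p26's `term311Z[Λ, Λ′]` CONVERGES TO (MINUS) THE FULL
(3.15) OF `B3Bound316ZeroLattice`** (`expr315L`, whose bracket sums `x′` over all of `ℤ³` — the print's *"Σ_{x′}η^d"* inside the
square bracket), provided every bracket series converges (for the (2.10) class: `summable_term315_of_exp`; for `G_k(0)`: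
`exists_bracket316L_bound`).  The limit is along the filter `atTop` of `Finset ℤ³`. [cite: Balaban1983Higgs3, (3.15) p.437] -/
theorem tendsto_term311Z (η : ℝ) (q : W →ₗ[ℝ] W) (Gj Gj' : KernelZ 2) (g g' : ZSite 3 → ℝ) (φ φ' : ZSite 3 → W)
    (Λ : Finset (ZSite 3)) (hsum : ∀ (μ : Fin 3), ∀ x ∈ Λ, Summable (term315 η Gj Gj' g g' (dispZ η) μ x)) :
    Tendsto (fun Λ' : Finset (ZSite 3) => term311Z η q Gj Gj' g g' φ φ' Λ Λ') atTop
      (𝓝 (-expr315L η q Gj Gj' g g' (dispZ η) Λ φ (fun μ => pd η⁻¹ μ φ'))) := by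
  simp only [term311Z_eq_sum_term315, expr315L, neg_neg]
  refine tendsto_finsetSum _ fun μ _ => tendsto_finsetSum _ fun x hx => ?_
  refine Tendsto.const_mul _ (Tendsto.mul_const _ ?_)
  exact (hsum μ x hx).hasSum

end Limit

/-! ## §3 (3.17) on the print's carrier -/

section Eq317

variable {ℓ k : ℕ} {a m2 : ℝ}
variable {W : Type*} [NormedAddCommGroup W] [InnerProductSpace ℝ W]

/-- **(3.17), THE IDENTITY, ON `ηℤ³` FOR THE PIECES OF `G_k(0)`** (p. 437: *"Thus we have finished the analysis of (3.8) and we can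
summarize it in the following graphical form (3.17)"*): for every `1 ≤ n ≤ k`, charge matrix, localizations, fields and finite
localization sets, the sum over the line indices `j, j′ < n` of the expressions (3.9) of the graph (3.8) built from the pieces
`G^η_{(j)}(0), G^η_{(j′)}(0)` EQUALS minus the local-vertex term (3.15) with both propagators resummed to `𝒢_n = Σ_{j<n}G^η_{(j)}(0)`
minus the sum of the generalized expressions (3.12) — p26's (3.11) `eq311Z` per pair and (3.15) `eq315Z_zeroLattice`, hypothesis-free.
[cite: Balaban1983Higgs3, (3.17) p.437] -/
theorem sum_expr39Z_eq {n : ℕ} (hn : 1 ≤ n) (hnk : n ≤ k) (q : W →ₗ[ℝ] W) (g g' : ZSite 3 → ℝ) (φ φ' : ZSite 3 → W)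
    (Λ Λ' : Finset (ZSite 3)) :
    ∑ j ∈ Finset.range n, ∑ j' ∈ Finset.range n,
        expr39Z (etaZ ℓ k) q (gpieceZ (d := 2) ℓ k j a m2) (gpieceZ ℓ k j' a m2) g g' φ φ' Λ Λ' =
      -term311Z (etaZ ℓ k) q (GresumZ (d := 2) ℓ k n a m2) (GresumZ ℓ k n a m2) g g' φ φ' Λ Λ' -
        ∑ j ∈ Finset.range n, ∑ j' ∈ Finset.range n,
          term312Z (etaZ ℓ k) q (gpieceZ (d := 2) ℓ k j a m2) (gpieceZ ℓ k j' a m2) g g' φ φ' Λ Λ' := by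
  rw [← eq315Z_zeroLattice hn hnk, ← Finset.sum_neg_distrib, ← Finset.sum_sub_distrib]
  refine Finset.sum_congr rfl fun j _ => ?_
  rw [← Finset.sum_neg_distrib, ← Finset.sum_sub_distrib]
  exact Finset.sum_congr rfl fun j' _ => eq311Z _ _ _ _ _ _ _ _ _ _

/-- **(3.17) AT THE TOP INDEX `j″ = k` WITH THE VERTEX IDENTIFIED**: the resummed term is p26's `term311Z` of `G^ξ_k(0) = GxiL ℓ k`
in BOTH slots (`GresumZ_top_eq_GxiL`), i.e. a partial sum of the (3.15) of `B3Bound316ZeroLattice` for the print's propagator.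
[cite: Balaban1983Higgs3, (3.17) p.437] -/
theorem sum_expr39Z_eq_top (hk : 1 ≤ k) (q : W →ₗ[ℝ] W) (g g' : ZSite 3 → ℝ) (φ φ' : ZSite 3 → W)
    (Λ Λ' : Finset (ZSite 3)) :
    ∑ j ∈ Finset.range k, ∑ j' ∈ Finset.range k,
        expr39Z (etaZ ℓ k) q (gpieceZ (d := 2) ℓ k j a m2) (gpieceZ ℓ k j' a m2) g g' φ φ' Λ Λ' =
      -term311Z (xiOf ℓ k) q (GxiL ℓ k a m2) (GxiL ℓ k a m2) g g' φ φ' Λ Λ' -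
        ∑ j ∈ Finset.range k, ∑ j' ∈ Finset.range k,
          term312Z (etaZ ℓ k) q (gpieceZ (d := 2) ℓ k j a m2) (gpieceZ ℓ k j' a m2) g g' φ φ' Λ Λ' := by
  rw [sum_expr39Z_eq hk le_rfl, GresumZ_top_eq_GxiL, etaZ_eq_xiOf]

/-- **THE RESUMMED TERM CONVERGES TO THE FULL LOCAL VERTEX (3.15) OF THE PRINT'S PROPAGATOR** as `Λ′ ↑ ℤ³`: for `k ≥ 1`, a window
point, `|g|,|g′| ≤ 1`: `term311Z[G^ξ_k(0), G^ξ_k(0)](Λ, Λ′) → −(3.15)[G^ξ_k(0), G^ξ_k(0)](Λ)` (`B3Bound316ZeroLattice.expr315L` with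
`D_μ = ∂^ξ_μφ′`), every bracket series converging absolutely (`exists_bracket315L_GxiL_bound`). [cite: Balaban1983Higgs3, (3.17) p.437] -/
theorem tendsto_term311Z_GxiL (hℓ : 1 ≤ ℓ) (hk : 1 ≤ k) (ha : 0 < a) (hm : 0 ≤ m2) (q : W →ₗ[ℝ] W)
    {g g' : ZSite 3 → ℝ} (hg : ∀ x, |g x| ≤ 1) (hg' : ∀ x, |g' x| ≤ 1) (φ φ' : ZSite 3 → W) (Λ : Finset (ZSite 3)) :
    Tendsto (fun Λ' : Finset (ZSite 3) => term311Z (xiOf ℓ k) q (GxiL ℓ k a m2) (GxiL ℓ k a m2) g g' φ φ' Λ Λ') atTop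
      (𝓝 (-expr315L (xiOf ℓ k) q (GxiL ℓ k a m2) (GxiL ℓ k a m2) g g' (dispZ (xiOf ℓ k)) Λ φ
        (fun μ => pd (xiOf ℓ k)⁻¹ μ φ'))) := by
  obtain ⟨Cst, -, h⟩ := exists_bracket315L_GxiL_bound hℓ a a m2 ha
  exact tendsto_term311Z _ q _ _ g g' φ φ' Λ fun μ x _ => (h k hk a m2 le_rfl le_rfl hm le_rfl g g' hg hg' μ x).1

/-- **(3.17) p. 437 [PDF 27] ON THE PRINT'S CARRIER, END TO END** — *"Thus we have finished the analysis of (3.8) and we can summarize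
it in the following graphical form [(3.8) summed = (generalized graph (3.12)) + (local vertex)] (3.17). It is of the required form
(3.5)."* — for the infinite-lattice zero-field propagator `G_k(0) = G_k(ηℤ³,0)` and its (2.6)-pieces (`d = 3`, `L = ℓ + 1 ≥ 2`, a
window `[a₋,a₊] × [0,m²₊]`, `a₋ > 0`): there are `δ′, C′, Cst > 0` (functions of `L` and the window) such that for EVERY `k ≥ 1`
(`η = L^{−k}`, `k = j″`), every window point, charge matrix `q` with `‖qw‖ ≤ Q‖w‖`, localizations `|g|,|g′| ≤ 1`, fields `φ, φ′` and
finite localization sets `Λ ∋ x`, `Λ′ ∋ x′`: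
(a) THE IDENTITY `Σ_{j,j′<k}(3.9)[G^η_{(j)}(0),G^η_{(j′)}(0)] = −term311Z[G_k(0),G_k(0)](Λ,Λ′) − Σ_{j,j′<k}(3.12)[j,j′]`;
(b) THE VERTEX: as `Λ′ ↑ ℤ³` the resummed term converges to `−(3.15)[G_k(0),G_k(0)](Λ)` (full lattice sum inside the bracket), and
`|(3.15)| ≤ Cst·Σ_μΣ_{x∈Λ}η³‖φ(x)‖‖q²(∂^η_μφ′)(x)‖` — *"a vertex with a bounded function"* (`B3Bound316ZeroLattice`, via (3.16));
(c) THE GENERALIZED GRAPHS: every piece `(j, j′)` obeys the generalized-graph estimate (3.13) with the printed factors, for Hölder-`α`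
legs `‖(∂^η_μφ′)(z) − (∂^η_μφ′)(z′)‖ ≤ H(η|z−z′|₁)^α` (p26's `abs_term312Z_le_zeroLattice`) — i.e. the summed expression of (3.8) IS
"Σ generalized expressions of degree −d+3+α" + "a local vertex with a bounded coefficient", the required form (3.5) for this graph.
[cite: Balaban1983Higgs3, (3.17) p.437] -/
theorem eq317_zeroLattice (hℓ : 1 ≤ ℓ) (amin aplus m2plus : ℝ) (ha : 0 < amin) :
    ∃ δ' C' Cst : ℝ, 0 < δ' ∧ 0 < C' ∧ 0 < Cst ∧ ∀ (k : ℕ), 1 ≤ k → ∀ (a m2 : ℝ), amin ≤ a → a ≤ aplus → 0 ≤ m2 →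
      m2 ≤ m2plus → ∀ {α H Q : ℝ}, 0 ≤ α → α ≤ 1 → 0 ≤ H → 0 ≤ Q → ∀ (q : W →ₗ[ℝ] W), (∀ w : W, ‖q w‖ ≤ Q * ‖w‖) →
      ∀ (g g' : ZSite 3 → ℝ), (∀ x, |g x| ≤ 1) → (∀ x, |g' x| ≤ 1) → ∀ (φ φ' : ZSite 3 → W),
        (∀ (μ : Fin 3) (z z' : ZSite 3),
          ‖pd (etaZ ℓ k)⁻¹ μ φ' z - pd (etaZ ℓ k)⁻¹ μ φ' z'‖ ≤ H * (etaZ ℓ k * dist₁ z z') ^ α) →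
      ∀ (Λ : Finset (ZSite 3)),
        -- (a) the identity, for every `Λ′`
        (∀ Λ' : Finset (ZSite 3),
          ∑ j ∈ Finset.range k, ∑ j' ∈ Finset.range k,
              expr39Z (etaZ ℓ k) q (gpieceZ (d := 2) ℓ k j a m2) (gpieceZ ℓ k j' a m2) g g' φ φ' Λ Λ' =
            -term311Z (xiOf ℓ k) q (GxiL ℓ k a m2) (GxiL ℓ k a m2) g g' φ φ' Λ Λ' -
              ∑ j ∈ Finset.range k, ∑ j' ∈ Finset.range k,
                term312Z (etaZ ℓ k) q (gpieceZ (d := 2) ℓ k j a m2) (gpieceZ ℓ k j' a m2) g g' φ φ' Λ Λ') ∧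
        -- (b) the vertex: limit and bound
        Tendsto (fun Λ' : Finset (ZSite 3) => term311Z (xiOf ℓ k) q (GxiL ℓ k a m2) (GxiL ℓ k a m2) g g' φ φ' Λ Λ')
            atTop (𝓝 (-expr315L (xiOf ℓ k) q (GxiL ℓ k a m2) (GxiL ℓ k a m2) g g' (dispZ (xiOf ℓ k)) Λ φ
              (fun μ => pd (xiOf ℓ k)⁻¹ μ φ'))) ∧
        |expr315L (xiOf ℓ k) q (GxiL ℓ k a m2) (GxiL ℓ k a m2) g g' (dispZ (xiOf ℓ k)) Λ φ
            (fun μ => pd (xiOf ℓ k)⁻¹ μ φ')| ≤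
          Cst * ∑ μ : Fin 3, ∑ x ∈ Λ, (xiOf ℓ k) ^ 3 * (‖φ x‖ * ‖q (q (pd (xiOf ℓ k)⁻¹ μ φ' x))‖) ∧
        -- (c) (3.13) for every piece
        (∀ (j j' : ℕ) (Λ' : Finset (ZSite 3)),
          |term312Z (etaZ ℓ k) q (gpieceZ (d := 2) ℓ k j a m2) (gpieceZ ℓ k j' a m2) g g' φ φ' Λ Λ'| ≤
            C' * Q ^ 2 * H * (min (scaleZ ℓ k j) (scaleZ ℓ k j') * (min (scaleZ ℓ k j) (scaleZ ℓ k j')) ^ α) *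
              ∑ x ∈ Λ, ∑ x' ∈ Λ', etaZ ℓ k ^ (2 * (2 + 1)) *
                (‖φ x‖ * (scaleZ ℓ k j ^ (-((2 + 1 : ℕ) : ℝ)) *
                    Real.exp (-(δ' / 2 * (scaleZ ℓ k j)⁻¹ * (etaZ ℓ k * dist₁ x x'))))
                  * (scaleZ ℓ k j' ^ (2 - ((2 + 1 : ℕ) : ℝ)) *
                    Real.exp (-(δ' / 2 * (scaleZ ℓ k j')⁻¹ * (etaZ ℓ k * dist₁ x x')))))) := by
  obtain ⟨δ', C', hδ', hC', h313⟩ := abs_term312Z_le_zeroLattice 2 ℓ hℓ amin aplus m2plus ha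
  obtain ⟨Cst, hCst, hV⟩ := exists_expr315L_GxiL_bound (W := W) hℓ amin aplus m2plus ha
  refine ⟨δ', C', Cst, hδ', hC', hCst, ?_⟩
  intro k hk a m2 ha1 ha2 hm1 hm2 α H Q hα0 hα1 hH hQ q hq g g' hg hg' φ φ' hφ' Λ
  refine ⟨fun Λ' => sum_expr39Z_eq_top hk q g g' φ φ' Λ Λ', ?_, ?_, fun j j' Λ' => ?_⟩
  · exact tendsto_term311Z_GxiL hℓ hk (ha.trans_le ha1) hm1 q hg hg' φ φ' Λ
  · exact hV k hk a m2 ha1 ha2 hm1 hm2 g g' hg hg' q Λ φ _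
  · exact h313 k hk a m2 ha1 ha2 hm1 hm2 j j' hα0 hα1 hH hQ q hq g g' hg hg' φ φ' hφ' Λ Λ'

end Eq317

end

end Literature.MathematicalPhysics.QuantumFieldTheory.Balaban1983to89.B3Eq317ZeroLattice
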